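import Literature.Barriers.Parity.SiegelZeroDichotomyPairHL
import Literature.Barriers.Parity.SiegelZeroDichotomyChowla
import Literature.NumberTheory.Sieve.PrimePairsSieveBound
import HarnessLib

/-!
# The von Mangoldt side of the Siegel-zero dichotomy: the proof architecture of
# `TaoTeravainen2021_pairHL` (Tao–Teräväinen 2022, Corollary 1.8 (i) = Theorem 1.6 with `k = 2`, `ℓ = 0`)

Topic `Literature/Barriers/Parity`, companion of `SiegelZeroDichotomyPairHL.lean`, whose named fact
`Literature.Barriers.Parity.TaoTeravainen2021_pairHL` is Tao–Teräväinen's Corollary 1.8 (i): for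
distinct fixed shifts `h₁, h₂ ≥ 1` and fixed `0 < ε₀ < 1`,
`𝔼_{n ≤ x} Λ(n+h₁)Λ(n+h₂) = 𝔖 + O(log^{-1/20} η)` uniformly over Siegel zeros (`IsSiegelZero χ η`,
Definition 1.4) and `q_χ^{41/2+ε₀} ≤ x ≤ q_χ^{η^{1/2}}`. The source obtains it as "a direct corollary
to Theorem 1.6" (the case `k = 2`, `ℓ = 0`), and proves Theorem 1.6 by the chain (1.5):
"`𝔼 Λ⋯Λ λ⋯λ ≈(i) 𝔼 Λ⋯Λ λ_Siegel⋯ ≈(ii) 𝔼 Λ_Siegel⋯ λ_Siegel⋯ ≈(iii) 𝔼 Λ_Siegel⋯ λ♯_Siegel⋯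
≈(iv) 𝔼 Λ♯_Siegel⋯ λ♯_Siegel⋯ ≈(v) 𝔖`"; §8: "Clearly Theorem 1.6 follows immediately from
concatenating together Propositions 4.2, 5.2, 6.3, 7.2, 8.1 using (1.5)." For `ℓ = 0` steps (i)
and (iii) are void, and the chain is `𝔼 Λ(n+h₁)Λ(n+h₂) ≈ 𝔼 Λ_Siegel(n+h₁)Λ_Siegel(n+h₂)`
(Proposition 5.2) `≈ 𝔼 Λ♯_Siegel(n+h₁)Λ♯_Siegel(n+h₂)` (Proposition 7.2, "Assume `k ≤ 2`")
`≈ 𝔖` (Proposition 8.1, the case `ℓ = 0`). This is the `k = 2` counterpart of the tree file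
`SiegelZeroDichotomyChowla.lean` (the `k = 0` architecture of `TaoTeravainen2021_chowla`), whose
objects `IsSmoothCutoff`, `realChar` are reused.
[cite: TaoTeravainen2021, §1.2 (1.5), §8 (first paragraph), Corollary 1.8 (i)]

This file records the top layer of that proof DAG, sorry-free:

* the objects of the source at `k = 2`, as real definitions (namespace
  `Literature.Barriers.Parity.TaoTeravainen`): the smooth cutoff `ψ_{≤z}(n) := ψ(log_z n)` ((2.12))
  = `cutoffLE ψ z`; the Selberg sieve `ν(n) := (∑_{d ∣ n} μ(d) ψ_{≤R}(d))²` ((2.14)) =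
  `selbergSieve ψ R`; the convolution `χ ∗ log` = `charLog χ`; the Siegel model of the von Mangoldt
  function `Λ_Siegel := (χ ∗ log) ν` (§5) = `vonMangoldtSiegel χ ψ R`; the scale
  `R := x^{1/log^{1/(5 max(1,k))} η}` ((2.3)) at `k = 2`, `R = x^{1/log^{1/10} η}` = `pairScaleR η x`;
  and the pair average `𝔼_{n ≤ x} f(n+h₁) f(n+h₂)` = `pairAverage f h₁ h₂ x`;
* the two steps as NAMED FACTS, in their `k = 2`, `ℓ = 0` specialisations:
  `TaoTeravainen2021_prop52_pair` (step (ii), Proposition 5.2) and `TaoTeravainen2021_prop72_81_pair`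
  (steps (iv)–(v), Propositions 7.2 and 8.1 concatenated, whose statement involves `Λ_Siegel` and
  `𝔖` only — the Type I approximant `Λ♯_Siegel` of (7.3) is internal to it);
* PROVED: the a-priori bound `𝔼_{n ≤ x} Λ(n+h₁)Λ(n+h₂) ≪_{h₁,h₂} 1` for all `x` ("otherwise the
  claim follows from standard upper bound sieves", §2.1) — `abs_vonMangoldtPairAverage_le`, from the
  tree's proved pair sieve bound `Literature.NumberTheory.Sieve.primePairs_card_le` and
  `Literature.NumberTheory.Sieve.card_higherPrimePowers_le`;
* PROVED: the assembly `TaoTeravainen2021_pairHL_of_siegelModel : prop52_pair → prop72_81_pair →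
  TaoTeravainen2021_pairHL` (the concatenation of §8 plus the bookkeeping of §2.1: a cutoff `ψ` is
  fixed, `ε₀` is shrunk, the errors add for `η ≥ η₁`, and for `η < η₁` the a-priori bound is used).

The discharge `TaoTeravainen2021_pairHL_holds` is thereby reduced to the two step facts; their own
inputs in the source are Lemma 5.1, Lemma 3.4 (the Selberg sieve on progressions), Lemma 3.2,
Landreau's inequality (3.9), Mertens' theorems and Corollary 3.6 (from Proposition 3.5 — tree:
`Literature.NumberTheory.LFunctions.TaoTeravainen2021_prop35`) for step (ii); Proposition 7.1 (level of distribution `2/3`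
of `Λ♭_Siegel`, from the Weil–Estermann Kloosterman bound via Lemmas 3.8–3.9) for step (iv); and
Lemma 3.7 (Weil bound for character sums with polynomial argument), Lemma 3.3, Lemma 8.2 and the
Euler-product computation (8.12)–(8.19) for step (v). [cite: TaoTeravainen2021, §3, §5, §7, §8]

## What the source prints (arXiv:2109.06291, TeX text read in full; numbering of the journal version)

* §2.1: "`X = O(Y)` to denote the bound `|X| ≤ CY` where `C` is a constant which is allowed to
  depend on the "fixed" quantities `k, ℓ, h₁, …, h_k, h'₁, …, h'_ℓ, ε₀`; we permit the constants to
  be ineffective"; "By shrinking `ε₀` if necessary, we may assume that `ε₀` is sufficiently small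
  depending on `k, ℓ`. We will also assume that `η` is sufficiently large depending on the fixed
  quantities, since otherwise the claim follows from standard upper bound sieves (such as
  Lemma 3.2)". (2.6): "`X ≈ Y`" abbreviates "`X = Y + O(1/log^{1/(10 max(1,k))} η)`".
* §2.4 (2.3): "`R := x^{1/log^{1/(5 max(1,k))} η}`". §2.5 (2.12), (2.14): "`ψ_{≤z}(n) := ψ(log_z n)`",
  "`ν(n) := (∑_{d ∣ n} μ(d) ψ_{≤R}(d))²`. Note that `ν` is an upper bound sieve for `1_{(>R)}`".
* §5: "it is then natural to introduce the Siegel approximant `Λ_Siegel := (χ ∗ log) ν`."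
  Proposition 5.2 (Replacing `Λ` with a Siegel model): "`𝔼_{n ≤ x} Λ(n+h₁)⋯Λ(n+h_k)
  λ_Siegel(n+h'₁)⋯λ_Siegel(n+h'_ℓ) ≈ 𝔼_{n ≤ x} Λ_Siegel(n+h₁)⋯Λ_Siegel(n+h_k) λ_Siegel(n+h'₁)⋯
  λ_Siegel(n+h'_ℓ)`."
* Proposition 7.2 (Replacing `Λ_Siegel` with a Type I approximant): "Assume `k ≤ 2`. Then we have
  `𝔼_{n ≤ x} Λ_Siegel(n+h₁)⋯Λ_Siegel(n+h_k) λ♯_Siegel(n+h'₁)⋯λ♯_Siegel(n+h'_ℓ) ≈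
  𝔼_{n ≤ x} Λ♯_Siegel(n+h₁)⋯Λ♯_Siegel(n+h_k) λ♯_Siegel(n+h'₁)⋯λ♯_Siegel(n+h'_ℓ)`."
  Proposition 8.1 (Evaluating the Type I correlation): "`𝔼_{n ≤ x} Λ♯_Siegel(n+h₁)⋯Λ♯_Siegel(n+h_k)
  λ♯_Siegel(n+h'₁)⋯λ♯_Siegel(n+h'_ℓ) ≈ 𝔖` where `𝔖` is the quantity in Conjecture 1.3."
* (1.2)–(1.3): `𝔖 := ∏_p β_p`, `β_p = (1 - 1/p)^{-k}(1 - |{h₁,…,h_k} (mod p)|/p)` — the tree's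
  `Literature.NumberTheory.Sieve.singularSeries {h₁, h₂}` (as in `TaoTeravainen2021_pairHL`).

## Design notes

1. `k = 2`, `ℓ = 0` throughout (`max(1,k) = 2`, exponent `1/20`, range exponent `10k + 1/2 = 41/2`):
   the facts are the printed propositions restricted to this case, which only weakens them;
   `𝔼_{n ≤ x}` is the average over `1 ≤ n ≤ x` with `x ∈ ℕ`, shifts natural numbers `≥ 1`, exactly as
   in `TaoTeravainen2021_pairHL` (`vonMangoldtPairAverage`).
2. Quantifier shape of "`≈`" under the standing assumptions of §2.1, copied from the `k = 0` file:
   after the fixed data (`h₁, h₂, ψ`) comes `∃ ε₁ > 0` ("shrinking `ε₀` … depending on `k, ℓ`";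
   letting it depend on all fixed data is weaker), then `∀ ε₀ ∈ (0, ε₁]`, then `∃ C η₁` (the implied
   constant and "η sufficiently large depending on the fixed quantities"), then all Siegel zeros
   (`IsSiegelZero`, any conductor) with `η ≥ η₁` and all `x` in the range (1.7) for `k = 2`.
3. `χ` enters the real-valued objects through `realChar χ n = Re χ(n)` (`χ` is quadratic, so
   `χ(n) ∈ {0, ±1}`); `ψ` is universally quantified over `IsSmoothCutoff` (the source fixes one such
   `ψ`; every choice is covered). Steps (iv) and (v) are vendored as ONE fact because their common
   intermediate `Λ♯_Siegel` ((7.3): three `t`-integrals of `χ ∗ Φ_t` against a second bump `φ` and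
   the cutoffs `ψ_{≤(Dq_χ²)²}(x/t)`, `ψ_{>(Dq_χ²)²}(x/t)`) does not occur in the concatenated
   statement; splitting it (with `Λ♯_Siegel` as a definition) is the next layer of the DAG.
4. NOT here: `Λ♯_Siegel`, `D`, `R₀`, Propositions 7.1/7.2/8.1 separately, and the proofs of the two
   steps — they are the remaining work towards `TaoTeravainen2021_pairHL_holds`.
-/

noncomputable section

open Filter Finset
open scoped ArithmeticFunction.vonMangoldt ArithmeticFunction.Moebius Topology ContDiff

namespace Literature.Barriers.Parity

namespace TaoTeravainen

/-! ### The objects of the source (`k = 2`) -/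

/-- The smooth cutoff `ψ_{≤z}(n) := ψ(log_z n) = ψ(log n / log z)` of (2.12), for the fixed `ψ` of
§2.5 (`IsSmoothCutoff`): equal to `1` for `n ≤ z^{1/2}` and to `0` for `n ≥ z` (`n ≥ 1`, `z > 1`).
[cite: TaoTeravainen2021, §2.5 (2.12)] -/
def cutoffLE (ψ : ℝ → ℝ) (z : ℝ) (n : ℕ) : ℝ :=
  ψ (Real.log n / Real.log z)

/-- `ψ_{≤z}(1) = ψ(0)` (`= 1` for a smooth cutoff). [cite: TaoTeravainen2021, §2.5 (2.12)] -/
theorem cutoffLE_one (ψ : ℝ → ℝ) (z : ℝ) : cutoffLE ψ z 1 = ψ 0 := by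
  simp [cutoffLE]

/-- `ψ_{≤z}(1) = 1` for the cutoffs of §2.5. [cite: TaoTeravainen2021, §2.5 (2.12)] -/
theorem cutoffLE_one_of_isSmoothCutoff {ψ : ℝ → ℝ} (hψ : IsSmoothCutoff ψ) (z : ℝ) :
    cutoffLE ψ z 1 = 1 := by
  rw [cutoffLE_one]
  exact hψ.eq_one 0 (by norm_num)

/-- `ψ_{≤z}(n) = 0` once `n ≥ z > 1` (the cutoff is supported on `[-1, 1]`).
[cite: TaoTeravainen2021, §2.5 (2.12)] -/
theorem cutoffLE_eq_zero_of_le {ψ : ℝ → ℝ} (hψ : IsSmoothCutoff ψ) {z : ℝ} (hz : 1 < z) {n : ℕ}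
    (hn : z ≤ n) : cutoffLE ψ z n = 0 := by
  unfold cutoffLE
  refine hψ.eq_zero _ ?_
  have hlogz : 0 < Real.log z := Real.log_pos hz
  rw [le_abs]
  left
  rw [le_div_iff₀ hlogz, one_mul]
  exact Real.log_le_log (by linarith) hn

/-- **The Selberg sieve** `ν(n) := (∑_{d ∣ n} μ(d) ψ_{≤R}(d))²` of (2.14) ("the Selberg sieve with
smoothed coefficients, which were implicitly introduced by Goldston and Yıldırım"); "Note that `ν` is
an upper bound sieve for `1_{(>R)}`". [cite: TaoTeravainen2021, §2.5 (2.14)] -/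
def selbergSieve (ψ : ℝ → ℝ) (R : ℝ) (n : ℕ) : ℝ :=
  (∑ d ∈ n.divisors, (μ d : ℝ) * cutoffLE ψ R d) ^ 2

/-- `ν ≥ 0`. [cite: TaoTeravainen2021, §2.5 (2.14)–(2.15)] -/
theorem selbergSieve_nonneg (ψ : ℝ → ℝ) (R : ℝ) (n : ℕ) : 0 ≤ selbergSieve ψ R n :=
  sq_nonneg _

/-- `ν(1) = ψ(0)² ` (`= 1` for a smooth cutoff: `1` is `R`-rough). [cite: TaoTeravainen2021, §2.5 (2.14)–(2.15)] -/
theorem selbergSieve_one (ψ : ℝ → ℝ) (R : ℝ) : selbergSieve ψ R 1 = ψ 0 ^ 2 := by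
  simp [selbergSieve, cutoffLE]

/-- **The convolution `χ ∗ log`**: `(χ ∗ log)(n) = ∑_{de = n} χ(d) log e` (§2.3: "`f∗g(n) :=
∑_{d ∣ n} f(d) g(n/d)`"; §1.2: "the von Mangoldt function `Λ = μ ∗ log` similarly "pretends" to be
like `χ ∗ log`"), real-valued through `realChar`. [cite: TaoTeravainen2021, §1.2 and §5] -/
def charLog {q : ℕ} (χ : DirichletCharacter ℂ q) (n : ℕ) : ℝ :=
  ∑ p ∈ n.divisorsAntidiagonal, realChar χ p.1 * Real.log p.2

/-- `(χ ∗ log)(1) = 0`. [cite: TaoTeravainen2021, §5] -/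
theorem charLog_one {q : ℕ} (χ : DirichletCharacter ℂ q) : charLog χ 1 = 0 := by
  simp [charLog]

/-- **The Siegel model of the von Mangoldt function** `Λ_Siegel := (χ ∗ log) ν` ("Since `μ` is
expected to be close to `χ` on rough numbers, and the Selberg sieve `ν` is mostly restricted to such
numbers, it is then natural to introduce the Siegel approximant `Λ_Siegel := (χ ∗ log) ν`").
[cite: TaoTeravainen2021, §5 (display before (5.2))] -/
def vonMangoldtSiegel {q : ℕ} (χ : DirichletCharacter ℂ q) (ψ : ℝ → ℝ) (R : ℝ) (n : ℕ) : ℝ :=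
  charLog χ n * selbergSieve ψ R n

/-- `Λ_Siegel(1) = 0`. [cite: TaoTeravainen2021, §5] -/
theorem vonMangoldtSiegel_one {q : ℕ} (χ : DirichletCharacter ℂ q) (ψ : ℝ → ℝ) (R : ℝ) :
    vonMangoldtSiegel χ ψ R 1 = 0 := by
  simp [vonMangoldtSiegel, charLog_one]

/-- At a prime `p ≥ R > 1` the sieve weight is `ν(p) = ψ_{≤R}(1)² = 1` and
`Λ_Siegel(p) = (χ ∗ log)(p) = χ(1) log p + χ(p) log 1 = log p = Λ(p)`: the Siegel model agrees with
`Λ` at the `R`-rough primes ("`ν` is an upper bound sieve for `1_{(>R)}`", (2.15)).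
[cite: TaoTeravainen2021, §5 and §2.5 (2.15)] -/
theorem vonMangoldtSiegel_prime {q : ℕ} (χ : DirichletCharacter ℂ q) {ψ : ℝ → ℝ}
    (hψ : IsSmoothCutoff ψ) {R : ℝ} (hR : 1 < R) {p : ℕ} (hp : p.Prime) (hpR : R ≤ p) :
    vonMangoldtSiegel χ ψ R p = Real.log p := by
  unfold vonMangoldtSiegel selbergSieve charLog
  rw [Nat.Prime.divisors hp, ← Nat.map_div_right_divisors, Nat.Prime.divisors hp]
  have h1p : (1 : ℕ) ≠ p := hp.one_lt.ne
  have hpair : ((1 : ℕ), p) ≠ (p, 1) := by simp [h1p]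
  simp [Finset.sum_pair h1p, realChar, cutoffLE_one_of_isSmoothCutoff hψ,
    cutoffLE_eq_zero_of_le hψ hR hpR, Nat.div_self hp.pos, Finset.sum_pair hpair]

/-- The scale `R := x^{1/log^{1/(5 max(1,k))} η}` of (2.3) at `k = 2`: `R = x^{1/log^{1/10} η}`
(the `k = 0` scale is `scaleR`). [cite: TaoTeravainen2021, §2.4 (2.3)] -/
def pairScaleR (η x : ℝ) : ℝ :=
  x ^ (1 / Real.log η ^ ((1 : ℝ) / 10))

/-- `R ≥ 1` for `x ≥ 1`. [cite: TaoTeravainen2021, §2.4 (2.3)] -/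
theorem one_le_pairScaleR {η x : ℝ} (hη : 1 < η) (hx : 1 ≤ x) : 1 ≤ pairScaleR η x :=
  Real.one_le_rpow hx (by
    have := Real.rpow_nonneg (Real.log_pos hη).le ((1 : ℝ) / 10)
    positivity)

/-- `𝔼_{n ≤ x} f(n + h₁) f(n + h₂)` for a real sequence `f` (average over `1 ≤ n ≤ x`, `x ∈ ℕ`); at
`f = Λ` this is `vonMangoldtPairAverage`. [cite: TaoTeravainen2021, §1.1 (the notation `𝔼_{n ∈ A}`)] -/
def pairAverage (f : ℕ → ℝ) (h₁ h₂ : ℕ) (x : ℕ) : ℝ :=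
  (∑ n ∈ Icc 1 x, f (n + h₁) * f (n + h₂)) / x

/-- `vonMangoldtPairAverage` is the pair average of `Λ`. [folklore] -/
theorem vonMangoldtPairAverage_eq_pairAverage (h₁ h₂ x : ℕ) :
    vonMangoldtPairAverage h₁ h₂ x = pairAverage (fun n => Λ n) h₁ h₂ x :=
  rfl

/-- The pair average is symmetric in the shifts. [folklore] -/
theorem pairAverage_comm (f : ℕ → ℝ) (h₁ h₂ x : ℕ) :
    pairAverage f h₁ h₂ x = pairAverage f h₂ h₁ x := by
  unfold pairAverage
  simp_rw [mul_comm (f (_ + h₁))]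

end TaoTeravainen

open TaoTeravainen

/-! ### The a-priori bound: `𝔼_{n ≤ x} Λ(n+h₁)Λ(n+h₂) = O(1)` by the upper-bound sieve -/

/-- Shifting the pair sum: for `h₁ < h₂`,
`∑_{1 ≤ n ≤ x} Λ(n+h₁)Λ(n+h₂) ≤ ∑_{1 ≤ m ≤ x+h₁} Λ(m)Λ(m+(h₂-h₁))`. [folklore] -/
theorem pairSum_le_shiftedPairSum {h₁ h₂ : ℕ} (hlt : h₁ < h₂) (x : ℕ) :
    ∑ n ∈ Icc 1 x, Λ (n + h₁) * Λ (n + h₂) ≤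
      ∑ m ∈ Icc 1 (x + h₁), Λ m * Λ (m + (h₂ - h₁)) := by
  have hmap : ∑ n ∈ Icc 1 x, Λ (n + h₁) * Λ (n + h₂) =
      ∑ m ∈ (Icc 1 x).map (addRightEmbedding h₁), Λ m * Λ (m + (h₂ - h₁)) := by
    rw [Finset.sum_map]
    refine Finset.sum_congr rfl fun n _ => ?_
    simp only [addRightEmbedding_apply]
    rw [show n + h₁ + (h₂ - h₁) = n + h₂ by omega]
  rw [hmap, Finset.map_add_right_Icc]
  refine Finset.sum_le_sum_of_subset_of_nonneg (fun m hm => ?_) fun _ _ _ =>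
    mul_nonneg ArithmeticFunction.vonMangoldt_nonneg ArithmeticFunction.vonMangoldt_nonneg
  rw [Finset.mem_Icc] at hm ⊢
  omega

/-- **The upper-bound sieve for the `Λ`-weighted pair sum**: for a fixed shift `h ≥ 1` there is
`C = C(h)` with `∑_{1 ≤ m ≤ N} Λ(m)Λ(m+h) ≤ C N` for all `N`. Prime pairs `m, m + h ≤ N` number
`≪_h N/log² N` (tree: `Literature.NumberTheory.Sieve.primePairs_card_le`, proved from
the beta sieve) and weigh `≤ log²(N+h) ≤ 4 log² N` each; the `m` with `m` or `m + h` a higher prime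
power number `≪ √N log N` (`Literature.NumberTheory.Sieve.card_higherPrimePowers_le`) and contribute
`o(N)` (`eventually_pairSumBound_le`). This is the "standard upper bound sieve" bound that settles
the case `η = O(1)` of Corollary 1.8 (i) (§2.1). [folklore] -/
theorem shiftedPairSum_le {h : ℕ} (hh : 1 ≤ h) :
    ∃ C : ℝ, ∀ N : ℕ, ∑ m ∈ Icc 1 N, Λ m * Λ (m + h) ≤ C * N := by
  classical
  obtain ⟨C₀, hC₀⟩ := Literature.NumberTheory.Sieve.primePairs_card_le
  obtain ⟨X₁, hX₁⟩ := eventually_atTop.mp (eventually_pairSumBound_le 0 one_pos)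
  -- the constants
  set w : ℝ := (h : ℝ) / Nat.totient h with hw_def
  have hw0 : 0 ≤ w := by positivity
  set K : ℝ := 4 * (max C₀ 0 * w) + 2 with hK_def
  have hK0 : 0 ≤ K := by positivity
  -- the sum and its monotonicity
  set S : ℕ → ℝ := fun N => ∑ m ∈ Icc 1 N, Λ m * Λ (m + h) with hS_def
  have hS_nonneg : ∀ N, 0 ≤ S N := fun N =>
    Finset.sum_nonneg fun _ _ =>
      mul_nonneg ArithmeticFunction.vonMangoldt_nonneg ArithmeticFunction.vonMangoldt_nonneg
  have hS_mono : Monotone S := by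
    intro a b hab
    exact Finset.sum_le_sum_of_subset_of_nonneg (Finset.Icc_subset_Icc_right hab) fun _ _ _ =>
      mul_nonneg ArithmeticFunction.vonMangoldt_nonneg ArithmeticFunction.vonMangoldt_nonneg
  -- the threshold
  set N₂ : ℕ := max (max h 2) (⌈X₁⌉₊ + 2) with hN₂_def
  have hN₂h : h ≤ N₂ := (le_max_left _ _).trans (le_max_left _ _)
  have hN₂2 : 2 ≤ N₂ := (le_max_right _ _).trans (le_max_left _ _)
  have hN₂X : ⌈X₁⌉₊ + 2 ≤ N₂ := le_max_right _ _
  -- the main estimate for `N ≥ N₂`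
  have hmain : ∀ N : ℕ, N₂ ≤ N → S N ≤ K * N := by
    intro N hN
    have hhN : h ≤ N := hN₂h.trans hN
    have h2N : 2 ≤ N := hN₂2.trans hN
    have hXN : ⌈X₁⌉₊ + 2 ≤ N := hN₂X.trans hN
    have hN0 : (0 : ℝ) < N := by exact_mod_cast (show 0 < N by omega)
    have hN2r : (2 : ℝ) ≤ N := by exact_mod_cast h2N
    set L : ℝ := Real.log ((N : ℝ) + h) ^ 2 with hL_def
    have hL0 : 0 ≤ L := sq_nonneg _
    set A := (Icc 1 N).filter fun m => m.Prime ∧ (m + h).Prime with hA_def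
    set B := (Icc 1 N).filter fun m =>
        (IsPrimePow m ∧ ¬ m.Prime) ∨ (IsPrimePow (m + h) ∧ ¬ (m + h).Prime) with hB_def
    -- termwise bound
    have hterm : ∀ m ∈ Icc 1 N, Λ m * Λ (m + h) ≤
        (if m ∈ A then L else 0) + (if m ∈ B then L else 0) := by
      intro m hm
      have hmN : m ≤ N := (mem_Icc.mp hm).2
      have hm1 : 1 ≤ m := (mem_Icc.mp hm).1
      have hA0 : (0 : ℝ) ≤ (if m ∈ A then L else 0) := by split_ifs <;> simp [hL0]
      have hB0 : (0 : ℝ) ≤ (if m ∈ B then L else 0) := by split_ifs <;> simp [hL0]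
      have h0m : 0 ≤ Λ m := ArithmeticFunction.vonMangoldt_nonneg
      have h0m2 : 0 ≤ Λ (m + h) := ArithmeticFunction.vonMangoldt_nonneg
      have hlogm : Λ m ≤ Real.log m := ArithmeticFunction.vonMangoldt_le_log
      have hlogm2 : Λ (m + h) ≤ Real.log ((m : ℝ) + h) := by
        have := ArithmeticFunction.vonMangoldt_le_log (n := m + h)
        push_cast at this
        exact this
      have hm0 : (1 : ℝ) ≤ m := by exact_mod_cast hm1
      have hmN' : (m : ℝ) ≤ N := by exact_mod_cast hmN
      have hh0 : (0 : ℝ) ≤ h := Nat.cast_nonneg h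
      have hlog0 : 0 ≤ Real.log m := Real.log_nonneg hm0
      have hb : Λ m * Λ (m + h) ≤ L := by
        calc Λ m * Λ (m + h) ≤ Real.log m * Real.log ((m : ℝ) + h) :=
              mul_le_mul hlogm hlogm2 h0m2 hlog0
          _ ≤ Real.log ((N : ℝ) + h) * Real.log ((N : ℝ) + h) := by
              apply mul_le_mul
              · exact Real.log_le_log (by linarith) (by linarith)
              · exact Real.log_le_log (by linarith) (by linarith)
              · exact Real.log_nonneg (by linarith)
              · exact Real.log_nonneg (by linarith)
          _ = L := by rw [hL_def, sq]
      by_cases h1 : IsPrimePow m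
      · by_cases h2 : IsPrimePow (m + h)
        · by_cases hp : m.Prime ∧ (m + h).Prime
          · have hAm : m ∈ A := mem_filter.mpr ⟨hm, hp⟩
            rw [if_pos hAm]
            linarith
          · have hBm : m ∈ B := by
              refine mem_filter.mpr ⟨hm, ?_⟩
              by_cases hpm : m.Prime
              · exact Or.inr ⟨h2, fun h' => hp ⟨hpm, h'⟩⟩
              · exact Or.inl ⟨h1, hpm⟩
            rw [if_pos hBm]
            linarith
        · rw [ArithmeticFunction.vonMangoldt_eq_zero_iff.mpr h2, mul_zero]
          linarith
      · rw [ArithmeticFunction.vonMangoldt_eq_zero_iff.mpr h1, zero_mul]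
        linarith
    have hsum : S N ≤ ∑ m ∈ Icc 1 N, ((if m ∈ A then L else 0) + (if m ∈ B then L else 0)) :=
      Finset.sum_le_sum hterm
    rw [Finset.sum_add_distrib, Finset.sum_ite_mem, Finset.sum_ite_mem,
      inter_eq_right.mpr (Finset.filter_subset _ _), inter_eq_right.mpr (Finset.filter_subset _ _),
      Finset.sum_const, Finset.sum_const, nsmul_eq_mul, nsmul_eq_mul] at hsum
    -- `#A ≤ C₀ w N / log² N`
    have hAcard : (#A : ℝ) ≤ max C₀ 0 * (w * ((N : ℝ) / Real.log N ^ 2)) := by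
      have hsub : A ⊆ (Nat.primesLE N).filter fun p => (p + h).Prime := by
        intro m hm
        rw [hA_def, mem_filter, mem_Icc] at hm
        rw [mem_filter, Nat.mem_primesLE]
        exact ⟨⟨hm.1.2, hm.2.1⟩, hm.2.2⟩
      calc (#A : ℝ) ≤ #((Nat.primesLE N).filter fun p => (p + h).Prime) := by
            exact_mod_cast Finset.card_le_card hsub
        _ ≤ C₀ * (w * ((N : ℝ) / Real.log N ^ 2)) := hC₀ N h hh hhN h2N
        _ ≤ max C₀ 0 * (w * ((N : ℝ) / Real.log N ^ 2)) :=
            mul_le_mul_of_nonneg_right (le_max_left _ _) (by positivity)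
    -- `#B ≤ 2 · #(higher prime powers ≤ N + h)`
    set H := (Finset.range (N + h + 1)).filter fun m => IsPrimePow m ∧ ¬ m.Prime with hH_def
    have hHcard : #H ≤ (Nat.sqrt (N + h) + 1) * (Nat.log 2 (N + h) + 1) :=
      Literature.NumberTheory.Sieve.card_higherPrimePowers_le (N + h)
    have hBcard : #B ≤ 2 * #H := by
      have hB₁ : #((Icc 1 N).filter fun m => IsPrimePow m ∧ ¬ m.Prime) ≤ #H := by
        refine Finset.card_le_card fun m hm => ?_
        rw [mem_filter, mem_Icc] at hm
        rw [hH_def, mem_filter, Finset.mem_range]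
        exact ⟨by omega, hm.2⟩
      have hB₂ : #((Icc 1 N).filter fun m => IsPrimePow (m + h) ∧ ¬ (m + h).Prime) ≤ #H := by
        refine Finset.card_le_card_of_injOn (fun m => m + h) (fun m hm => ?_) ?_
        · rw [Finset.mem_coe, mem_filter, mem_Icc] at hm
          rw [Finset.mem_coe, hH_def, mem_filter, Finset.mem_range]
          exact ⟨show m + h < N + h + 1 by omega, hm.2⟩
        · intro a _ b _ hab
          simpa using hab
      have hBsub : B ⊆ ((Icc 1 N).filter fun m => IsPrimePow m ∧ ¬ m.Prime) ∪
          ((Icc 1 N).filter fun m => IsPrimePow (m + h) ∧ ¬ (m + h).Prime) := by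
        intro m hm
        rw [hB_def, mem_filter] at hm
        rw [mem_union, mem_filter, mem_filter]
        rcases hm.2 with h' | h'
        · exact Or.inl ⟨hm.1, h'⟩
        · exact Or.inr ⟨hm.1, h'⟩
      calc #B ≤ _ := Finset.card_le_card hBsub
        _ ≤ _ := Finset.card_union_le _ _
        _ ≤ 2 * #H := by omega
    -- the prime-pair part: `#A · L ≤ 4 C₀ w N`
    have hlogN : 0 < Real.log N := Real.log_pos (by linarith)
    have hlogNh : Real.log ((N : ℝ) + h) ≤ 2 * Real.log N := by
      have hhN' : (h : ℝ) ≤ N := by exact_mod_cast hhN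
      calc Real.log ((N : ℝ) + h) ≤ Real.log (2 * N) := Real.log_le_log (by linarith) (by linarith)
        _ = Real.log 2 + Real.log N := Real.log_mul (by norm_num) hN0.ne'
        _ ≤ Real.log N + Real.log N := by
            gcongr
        _ = 2 * Real.log N := by ring
    have hLle : L ≤ 4 * Real.log N ^ 2 := by
      have h0 : 0 ≤ Real.log ((N : ℝ) + h) := Real.log_nonneg (by linarith [Nat.cast_nonneg (α := ℝ) h])
      rw [hL_def]
      nlinarith
    have hApart : (#A : ℝ) * L ≤ 4 * (max C₀ 0 * w) * N := by
      calc (#A : ℝ) * L ≤ max C₀ 0 * (w * ((N : ℝ) / Real.log N ^ 2)) * (4 * Real.log N ^ 2) :=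
            mul_le_mul hAcard hLle hL0 (by positivity)
        _ = 4 * (max C₀ 0 * w) * N := by
            field_simp
    -- the higher-prime-power part: `#B · L ≤ 2 N`
    have hBpart : (#B : ℝ) * L ≤ 2 * N := by
      have hNh2 : 2 ≤ N + h := by omega
      have hXle : X₁ ≤ ((N + h - 2 : ℕ) : ℝ) := by
        have h1 : X₁ ≤ (⌈X₁⌉₊ : ℝ) := Nat.le_ceil X₁
        have h2 : (⌈X₁⌉₊ : ℝ) ≤ ((N + h - 2 : ℕ) : ℝ) := by exact_mod_cast (by omega)
        linarith
      have hb := hX₁ ((N + h - 2 : ℕ) : ℝ) hXle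
      rw [Nat.floor_natCast, Nat.sub_add_cancel hNh2] at hb
      have hcast : (((N + h - 2 : ℕ) : ℕ) : ℝ) + 2 = (N : ℝ) + h := by
        rw [Nat.cast_sub hNh2]
        push_cast
        ring
      rw [hcast] at hb
      simp only [Nat.cast_zero, zero_mul, zero_add, one_mul] at hb
      have hB' : (#B : ℝ) ≤ 2 * (((Nat.sqrt (N + h) + 1) * (Nat.log 2 (N + h) + 1) : ℕ) : ℝ) := by
        have : (#B : ℝ) ≤ 2 * (#H : ℝ) := by exact_mod_cast hBcard
        have : (#H : ℝ) ≤ (((Nat.sqrt (N + h) + 1) * (Nat.log 2 (N + h) + 1) : ℕ) : ℝ) := by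
          exact_mod_cast hHcard
        linarith
      have hsub2 : ((N + h - 2 : ℕ) : ℝ) ≤ 2 * N := by
        rw [Nat.cast_sub hNh2]
        push_cast
        have : (h : ℝ) ≤ N := by exact_mod_cast hhN
        linarith
      calc (#B : ℝ) * L ≤ 2 * (((Nat.sqrt (N + h) + 1) * (Nat.log 2 (N + h) + 1) : ℕ) : ℝ) * L :=
            mul_le_mul_of_nonneg_right hB' hL0
        _ ≤ ((N + h - 2 : ℕ) : ℝ) := hb
        _ ≤ 2 * N := hsub2
    calc S N ≤ (#A : ℝ) * L + (#B : ℝ) * L := hsum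
      _ ≤ 4 * (max C₀ 0 * w) * N + 2 * N := add_le_add hApart hBpart
      _ = K * N := by rw [hK_def]; ring
  -- uniformly in `N`
  have hN₂1 : (1 : ℝ) ≤ N₂ := by exact_mod_cast (show 1 ≤ N₂ by omega)
  refine ⟨K * N₂, fun N => ?_⟩
  rcases Nat.eq_zero_or_pos N with rfl | hNpos
  · simp
  have hN1 : (1 : ℝ) ≤ N := by exact_mod_cast hNpos
  have hKN₂ : 0 ≤ K * N₂ := mul_nonneg hK0 (by positivity)
  rcases le_or_gt N₂ N with hle | hlt
  · calc S N ≤ K * N := hmain N hle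
      _ = K * 1 * N := by ring
      _ ≤ K * N₂ * N :=
          mul_le_mul_of_nonneg_right (mul_le_mul_of_nonneg_left hN₂1 hK0) (Nat.cast_nonneg N)
  · calc S N ≤ S N₂ := hS_mono hlt.le
      _ ≤ K * N₂ := hmain N₂ le_rfl
      _ ≤ K * N₂ * N := le_mul_of_one_le_right hKN₂ hN1

/-- **`𝔼_{n ≤ x} Λ(n+h₁)Λ(n+h₂) = O_{h₁,h₂}(1)`** for distinct shifts, uniformly in `x ∈ ℕ` (the
a-priori bound by "standard upper bound sieves" with which §2.1 settles the case `η = O(1)`).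
[folklore] -/
theorem abs_vonMangoldtPairAverage_le {h₁ h₂ : ℕ} (hne : h₁ ≠ h₂) :
    ∃ C : ℝ, ∀ x : ℕ, |vonMangoldtPairAverage h₁ h₂ x| ≤ C := by
  wlog hlt : h₁ < h₂ generalizing h₁ h₂
  · obtain ⟨C, hC⟩ := this hne.symm (lt_of_le_of_ne (not_lt.mp hlt) hne.symm)
    refine ⟨C, fun x => ?_⟩
    rw [vonMangoldtPairAverage_eq_pairAverage, pairAverage_comm, ← vonMangoldtPairAverage_eq_pairAverage]
    exact hC x
  obtain ⟨C, hC⟩ := shiftedPairSum_le (h := h₂ - h₁) (by omega)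
  refine ⟨max C 0 * (1 + h₁), fun x => ?_⟩
  have hsum0 : 0 ≤ ∑ n ∈ Icc 1 x, Λ (n + h₁) * Λ (n + h₂) :=
    Finset.sum_nonneg fun _ _ =>
      mul_nonneg ArithmeticFunction.vonMangoldt_nonneg ArithmeticFunction.vonMangoldt_nonneg
  unfold vonMangoldtPairAverage
  rcases Nat.eq_zero_or_pos x with rfl | hx
  · simp only [Nat.cast_zero, div_zero, abs_zero]
    positivity
  have hx' : (0 : ℝ) < x := by exact_mod_cast hx
  have hx1 : (1 : ℝ) ≤ x := by exact_mod_cast hx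
  rw [abs_div, abs_of_nonneg hsum0, abs_of_pos hx', div_le_iff₀ hx']
  have hh₁ : (0 : ℝ) ≤ h₁ := Nat.cast_nonneg h₁
  calc ∑ n ∈ Icc 1 x, Λ (n + h₁) * Λ (n + h₂)
      ≤ ∑ m ∈ Icc 1 (x + h₁), Λ m * Λ (m + (h₂ - h₁)) := pairSum_le_shiftedPairSum hlt x
    _ ≤ C * ((x + h₁ : ℕ) : ℝ) := hC (x + h₁)
    _ ≤ max C 0 * ((x + h₁ : ℕ) : ℝ) := mul_le_mul_of_nonneg_right (le_max_left _ _) (by positivity)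
    _ ≤ max C 0 * ((1 + h₁) * x) := by
        refine mul_le_mul_of_nonneg_left ?_ (le_max_right _ _)
        push_cast
        nlinarith
    _ = max C 0 * (1 + h₁) * x := by ring

/-! ### The two steps of the chain (1.5) at `k = 2`, `ℓ = 0`, as named facts -/

/-- **Tao–Teräväinen 2022, Proposition 5.2 (step (ii): replacing `Λ` with a Siegel model), case
`k = 2`, `ℓ = 0`.** For fixed distinct shifts `h₁, h₂ ≥ 1` and a fixed smooth cutoff `ψ` (§2.5),
after shrinking `ε₀` (`0 < ε₀ ≤ ε₁`), there are `C`, `η₁` (depending on the fixed quantities,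
ineffective) such that for every Siegel zero of quality `η ≥ η₁` and conductor `q` and all
`q^{41/2+ε₀} ≤ x ≤ q^{η^{1/2}}`:
`|𝔼_{n ≤ x} Λ(n+h₁)Λ(n+h₂) - 𝔼_{n ≤ x} Λ_Siegel(n+h₁)Λ_Siegel(n+h₂)| ≤ C / log^{1/20} η`, where
`Λ_Siegel = (χ ∗ log) ν`, `ν = (∑_{d ∣ n} μ(d) ψ_{≤R}(d))²`, `R = x^{1/log^{1/10} η}`. A NAMED FACT
(source inputs: (5.1), Lemma 5.1, Lemma 3.4, Lemma 3.2, Landreau's inequality (3.9), Mertens,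
Corollary 3.6). [cite: TaoTeravainen2021, Proposition 5.2 (with §2.1, (2.3), (2.6), (2.14), §5)] -/
def TaoTeravainen2021_prop52_pair : Prop :=
  ∀ h₁ h₂ : ℕ, 1 ≤ h₁ → 1 ≤ h₂ → h₁ ≠ h₂ → ∀ ψ : ℝ → ℝ, IsSmoothCutoff ψ →
    ∃ ε₁ : ℝ, 0 < ε₁ ∧ ∀ ε₀ : ℝ, 0 < ε₀ → ε₀ ≤ ε₁ →
      ∃ C η₁ : ℝ, ∀ (q : ℕ) [NeZero q] (χ : DirichletCharacter ℂ q) (η : ℝ), IsSiegelZero χ η →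
        η₁ ≤ η → ∀ x : ℕ, (q : ℝ) ^ ((41 : ℝ) / 2 + ε₀) ≤ x → (x : ℝ) ≤ (q : ℝ) ^ Real.sqrt η →
          |vonMangoldtPairAverage h₁ h₂ x -
              pairAverage (vonMangoldtSiegel χ ψ (pairScaleR η x)) h₁ h₂ x| ≤
            C / Real.log η ^ ((1 : ℝ) / 20)

/-- **Tao–Teräväinen 2022, Propositions 7.2 and 8.1 concatenated (steps (iv)–(v) of (1.5): the
Siegel-model correlation evaluates to the singular series), case `k = 2`, `ℓ = 0`.** For fixed
distinct shifts `h₁, h₂ ≥ 1` and a fixed smooth cutoff `ψ`, after shrinking `ε₀`, there are `C`, `η₁`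
such that for every Siegel zero of quality `η ≥ η₁` and conductor `q` and all
`q^{41/2+ε₀} ≤ x ≤ q^{η^{1/2}}`:
`|𝔼_{n ≤ x} Λ_Siegel(n+h₁)Λ_Siegel(n+h₂) - 𝔖| ≤ C / log^{1/20} η`, `𝔖 = ∏_p β_p` the singular
series (1.2) of `{h₁, h₂}` (`Literature.NumberTheory.Sieve.singularSeries`), `Λ_Siegel`, `R` as in
`TaoTeravainen2021_prop52_pair`. This is "(iv) ≈" (Proposition 7.2: "Assume `k ≤ 2`. Then
`𝔼 Λ_Siegel(n+h₁)⋯ ≈ 𝔼 Λ♯_Siegel(n+h₁)⋯`") followed by "(v) ≈ 𝔖" (Proposition 8.1), the Type I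
approximant `Λ♯_Siegel = (χ ∗ log)♯ ν` of (7.3) (built from a second fixed bump `φ` and the scale
`D = x^{ε₀/20}`) being internal to the concatenation. A NAMED FACT (source inputs: Proposition 7.1 —
Weil–Estermann Kloosterman bound, Lemmas 3.8–3.9 —, Lemma 3.7 — Weil bound for character sums —,
Lemmas 3.3, 8.2 and (8.12)–(8.19)).
[cite: TaoTeravainen2021, Propositions 7.2 and 8.1 (k = 2, ℓ = 0; with (1.5), §2.1, (2.3), (2.6), §5, (7.3))] -/
def TaoTeravainen2021_prop72_81_pair : Prop :=
  ∀ h₁ h₂ : ℕ, 1 ≤ h₁ → 1 ≤ h₂ → h₁ ≠ h₂ → ∀ ψ : ℝ → ℝ, IsSmoothCutoff ψ →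
    ∃ ε₁ : ℝ, 0 < ε₁ ∧ ∀ ε₀ : ℝ, 0 < ε₀ → ε₀ ≤ ε₁ →
      ∃ C η₁ : ℝ, ∀ (q : ℕ) [NeZero q] (χ : DirichletCharacter ℂ q) (η : ℝ), IsSiegelZero χ η →
        η₁ ≤ η → ∀ x : ℕ, (q : ℝ) ^ ((41 : ℝ) / 2 + ε₀) ≤ x → (x : ℝ) ≤ (q : ℝ) ^ Real.sqrt η →
          |pairAverage (vonMangoldtSiegel χ ψ (pairScaleR η x)) h₁ h₂ x -
              Literature.NumberTheory.Sieve.singularSeries ({(h₁ : ℤ), (h₂ : ℤ)} : Finset ℤ)| ≤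
            C / Real.log η ^ ((1 : ℝ) / 20)

/-! ### The assembly (§8, first paragraph, and §2.1), proved -/

/-- **Corollary 1.8 (i) from the two steps** ("Theorem 1.6 follows immediately from concatenating
together Propositions … 5.2, … 7.2, 8.1 using (1.5)", here with `k = 2`, `ℓ = 0`): given the facts
`TaoTeravainen2021_prop52_pair` and `TaoTeravainen2021_prop72_81_pair`, the named fact
`TaoTeravainen2021_pairHL` holds. Bookkeeping as in §2.1: fix a cutoff `ψ` (`exists_isSmoothCutoff`),
shrink `ε₀` to the least of the two thresholds (the range `q^{41/2+ε₀} ≤ x` only widens), add the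
two errors for `η ≥ max η₁`, and for smaller `η` use the a-priori bound
`abs_vonMangoldtPairAverage_le` ("otherwise the claim follows from standard upper bound sieves").
[cite: TaoTeravainen2021, §8 (first paragraph), §2.1 and Corollary 1.8 (i)] -/
theorem TaoTeravainen2021_pairHL_of_siegelModel (hA : TaoTeravainen2021_prop52_pair)
    (hB : TaoTeravainen2021_prop72_81_pair) : TaoTeravainen2021_pairHL := by
  intro h₁ h₂ hh₁ hh₂ hne ε₀ hε₀ _hε₀1
  obtain ⟨ψ, hψ⟩ := exists_isSmoothCutoff
  obtain ⟨εA, hεA, HA⟩ := hA h₁ h₂ hh₁ hh₂ hne ψ hψ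
  obtain ⟨εB, hεB, HB⟩ := hB h₁ h₂ hh₁ hh₂ hne ψ hψ
  obtain ⟨C₀, hC₀⟩ := abs_vonMangoldtPairAverage_le hne
  set ε : ℝ := min ε₀ (min εA εB) with hε
  have hε0 : 0 < ε := lt_min hε₀ (lt_min hεA hεB)
  have hεε₀ : ε ≤ ε₀ := min_le_left _ _
  have hεεA : ε ≤ εA := (min_le_right _ _).trans (min_le_left _ _)
  have hεεB : ε ≤ εB := (min_le_right _ _).trans (min_le_right _ _)
  obtain ⟨CA, ηA, hCA⟩ := HA ε hε0 hεεA
  obtain ⟨CB, ηB, hCB⟩ := HB ε hε0 hεεB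
  set 𝔖 : ℝ := Literature.NumberTheory.Sieve.singularSeries ({(h₁ : ℤ), (h₂ : ℤ)} : Finset ℤ)
    with h𝔖
  set η₀ : ℝ := max 10 (max ηA ηB) with hη₀
  have hη₀10 : 10 ≤ η₀ := le_max_left _ _
  have hηA₀ : ηA ≤ η₀ := le_max_of_le_right (le_max_left _ _)
  have hηB₀ : ηB ≤ η₀ := le_max_of_le_right (le_max_right _ _)
  have hC₀0 : 0 ≤ C₀ := (abs_nonneg _).trans (hC₀ 0)
  refine ⟨max (CA + CB) ((C₀ + |𝔖|) * Real.log η₀ ^ ((1 : ℝ) / 20)),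
    fun q _ χ η hS x hlo hhi => ?_⟩
  have hη10 : 10 ≤ η := hS.ten_le
  have hlogη : 0 < Real.log η := Real.log_pos (by linarith)
  have hL : 0 < Real.log η ^ ((1 : ℝ) / 20) := Real.rpow_pos_of_pos hlogη _
  rcases le_or_gt η₀ η with hge | hlt
  · -- `η` large: concatenate the two steps at the shrunk `ε`
    have hq1 : (1 : ℝ) ≤ q := by exact_mod_cast NeZero.one_le
    have hlo' : (q : ℝ) ^ ((41 : ℝ) / 2 + ε) ≤ x :=
      (Real.rpow_le_rpow_of_exponent_le hq1 (by linarith)).trans hlo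
    have eA := hCA q χ η hS (hηA₀.trans hge) x hlo' hhi
    have eB := hCB q χ η hS (hηB₀.trans hge) x hlo' hhi
    set A := vonMangoldtPairAverage h₁ h₂ x
    set M := pairAverage (vonMangoldtSiegel χ ψ (pairScaleR η x)) h₁ h₂ x
    calc |A - 𝔖| = |(A - M) + (M - 𝔖)| := by rw [show (A - M) + (M - 𝔖) = A - 𝔖 by ring]
      _ ≤ |A - M| + |M - 𝔖| := abs_add_le _ _
      _ ≤ CA / Real.log η ^ ((1 : ℝ) / 20) + CB / Real.log η ^ ((1 : ℝ) / 20) := add_le_add eA eB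
      _ = (CA + CB) / Real.log η ^ ((1 : ℝ) / 20) := by ring
      _ ≤ _ := div_le_div_of_nonneg_right (le_max_left _ _) hL.le
  · -- `η = O(1)`: the a-priori sieve bound
    have h2 : Real.log η ^ ((1 : ℝ) / 20) ≤ Real.log η₀ ^ ((1 : ℝ) / 20) :=
      Real.rpow_le_rpow hlogη.le (Real.log_le_log (by linarith) hlt.le) (by norm_num)
    have h3 : 0 ≤ C₀ + |𝔖| := by positivity
    calc |vonMangoldtPairAverage h₁ h₂ x - 𝔖|
        ≤ |vonMangoldtPairAverage h₁ h₂ x| + |𝔖| := abs_sub _ _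
      _ ≤ C₀ + |𝔖| := by gcongr; exact hC₀ x
      _ ≤ max (CA + CB) ((C₀ + |𝔖|) * Real.log η₀ ^ ((1 : ℝ) / 20)) /
            Real.log η ^ ((1 : ℝ) / 20) := by
          rw [le_div_iff₀ hL]
          calc (C₀ + |𝔖|) * Real.log η ^ ((1 : ℝ) / 20)
              ≤ (C₀ + |𝔖|) * Real.log η₀ ^ ((1 : ℝ) / 20) := mul_le_mul_of_nonneg_left h2 h3
            _ ≤ _ := le_max_right _ _

end Literature.Barriers.Parity
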